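import Mathlib
import HarnessLib
import Literature.Geometry.DiscreteGeometry.SphericalCodeHullEulerFormula

/-!
# Soft four-rings, endgame: bonded pairs inside a typed neighbourhood

Support file for `SoftFourRings` (route `PricedLinkCensus`, sub-problem `Crystallization`),
endgame (evidence file §12.8), point-level helpers: `bond_pair_typeA`, `bond_pair_typeO` (a
bonded pair inside `N(v)` is one of the two designated pairs of the type data),
`mem_or_of_pair_eq`, and reorderings of four-fold disjunctions.
-/

namespace Summit.AtomisticToContinuum.Crystallization.Theorems

open Real RealInnerProductSpace

section Pairs

variable {B : Finset (Finset (EuclideanSpace ℝ (Fin 3)))}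

/-- **Bonded pairs inside a type-A neighbourhood.** -/
theorem bond_pair_typeA {a b c d p q : EuclideanSpace ℝ (Fin 3)}
    (hac : ({a, c} : Finset (EuclideanSpace ℝ (Fin 3))) ∉ B)
    (had : ({a, d} : Finset (EuclideanSpace ℝ (Fin 3))) ∉ B)
    (hbd : ({b, d} : Finset (EuclideanSpace ℝ (Fin 3))) ∉ B)
    (hcd : ({c, d} : Finset (EuclideanSpace ℝ (Fin 3))) ∉ B)
    (hp : p = a ∨ p = b ∨ p = c ∨ p = d) (hq : q = a ∨ q = b ∨ q = c ∨ q = d) (hpq : p ≠ q)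
    (hB : ({p, q} : Finset (EuclideanSpace ℝ (Fin 3))) ∈ B) :
    ({p, q} : Finset (EuclideanSpace ℝ (Fin 3))) = {a, b} ∨
      ({p, q} : Finset (EuclideanSpace ℝ (Fin 3))) = {b, c} := by
  rcases hp with rfl | rfl | rfl | rfl <;> rcases hq with rfl | rfl | rfl | rfl
  all_goals first
    | exact absurd rfl hpq
    | exact Or.inl rfl
    | exact Or.inr rfl
    | exact Or.inl (Finset.pair_comm _ _)
    | exact Or.inr (Finset.pair_comm _ _)
    | exact absurd hB hac
    | exact absurd hB had
    | exact absurd hB hbd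
    | exact absurd hB hcd
    | (rw [Finset.pair_comm] at hB; first
        | exact absurd hB hac
        | exact absurd hB had
        | exact absurd hB hbd
        | exact absurd hB hcd)

/-- **Bonded pairs inside a type-O neighbourhood.** -/
theorem bond_pair_typeO {a b c d p q : EuclideanSpace ℝ (Fin 3)}
    (hac : ({a, c} : Finset (EuclideanSpace ℝ (Fin 3))) ∉ B)
    (had : ({a, d} : Finset (EuclideanSpace ℝ (Fin 3))) ∉ B)
    (hbc : ({b, c} : Finset (EuclideanSpace ℝ (Fin 3))) ∉ B)
    (hbd : ({b, d} : Finset (EuclideanSpace ℝ (Fin 3))) ∉ B)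
    (hp : p = a ∨ p = b ∨ p = c ∨ p = d) (hq : q = a ∨ q = b ∨ q = c ∨ q = d) (hpq : p ≠ q)
    (hB : ({p, q} : Finset (EuclideanSpace ℝ (Fin 3))) ∈ B) :
    ({p, q} : Finset (EuclideanSpace ℝ (Fin 3))) = {a, b} ∨
      ({p, q} : Finset (EuclideanSpace ℝ (Fin 3))) = {c, d} := by
  rcases hp with rfl | rfl | rfl | rfl <;> rcases hq with rfl | rfl | rfl | rfl
  all_goals first
    | exact absurd rfl hpq
    | exact Or.inl rfl
    | exact Or.inr rfl
    | exact Or.inl (Finset.pair_comm _ _)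
    | exact Or.inr (Finset.pair_comm _ _)
    | exact absurd hB hac
    | exact absurd hB had
    | exact absurd hB hbc
    | exact absurd hB hbd
    | (rw [Finset.pair_comm] at hB; first
        | exact absurd hB hac
        | exact absurd hB had
        | exact absurd hB hbc
        | exact absurd hB hbd)

/-- Membership of an element of a pair in a pair: `{p, q} = {x, y}` gives `p = x ∨ p = y` and
`q = x ∨ q = y`. -/
theorem mem_or_of_pair_eq {p q x y : EuclideanSpace ℝ (Fin 3)}
    (h : ({p, q} : Finset (EuclideanSpace ℝ (Fin 3))) = {x, y}) :
    (p = x ∨ p = y) ∧ (q = x ∨ q = y) := by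
  have hp : p ∈ ({x, y} : Finset (EuclideanSpace ℝ (Fin 3))) := by
    rw [← h]; exact Finset.mem_insert_self _ _
  have hq : q ∈ ({x, y} : Finset (EuclideanSpace ℝ (Fin 3))) := by
    rw [← h]; exact Finset.mem_insert_of_mem (Finset.mem_singleton_self _)
  rw [Finset.mem_insert, Finset.mem_singleton] at hp hq
  exact ⟨hp, hq⟩

end Pairs

/-- Reordering a four-fold disjunction (swap the first two). -/
theorem or4_swap12 {p q r s : Prop} : (p ∨ q ∨ r ∨ s) ↔ (q ∨ p ∨ r ∨ s) := by tauto

/-- Reordering a four-fold disjunction (rotate by two). -/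
theorem or4_rot2 {p q r s : Prop} : (p ∨ q ∨ r ∨ s) ↔ (r ∨ s ∨ p ∨ q) := by tauto

end Summit.AtomisticToContinuum.Crystallization.Theorems
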